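import Literature.NumberTheory.LFunctions.YoshidaWindowGramFrontDoorJ
import HarnessLib

/-!
# Kernel enclosures of Yoshida's matrix coefficients — VIII-a: the MEAN-SQUARE order-`J` tail matrices as real functions

Source: H. Yoshida, Adv. Stud. Pure Math. **21** (1992) 281–325, §§6–7 [Yoshida1992HermitianForms].  The MEAN-SQUARE
tail lever of the format-C certificate (rh-explicit weil-10, 2026-08-22: `WeilFormatC.even_tailJMS_majorant_matrix` /
`odd_tailJMS_majorant_matrix`, consumed by the GENERIC door `weilPositivityOn_of_formatC_kernels`) replaces the tail sup
`C_A²` of the order-`J` matrices (part VII-a) by a mean-square constant `(π/4 + a(1+E)/(πB₃))² + ½Σ_k Λ_k²/k + …` with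
guarded / crude resonance terms driven by sine lower-bound DATA `s₁ k ≤ |sin(π log k/(2a))|`,
`s∓ k k' ≤ |sin((π log k/a ∓ π log k'/a)/2)|` at the prime powers of the window (value `0` = crude).  This file transcribes the two
tail matrices VERBATIM as real functions on `ℕ × ℕ` (`Encl.U2EvenJMS`, `Encl.U2OddJMS`, the sine data as arguments) and
proves the bridges to the door's inline `Fin`-indexed expressions (`U2EvenJMS_fin`, `U2OddJMS_fin`).  Part VIII-b (boxes,
certified sine data, the `hS` packaging) follows.  Everything is proved; no named facts.
-/

open Real Complex Finset Matrix
open scoped BigOperators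

namespace Literature.NumberTheory.LFunctions.Yoshida1992

open Literature.Analysis.SpecialFunctions Literature.Analysis.ValidatedNumerics.NumericsMP
open Literature.Analysis.ValidatedNumerics
open scoped ArithmeticFunction.vonMangoldt

namespace Encl

variable {a : ℝ}

/-- **`U₂⁺` of the mean-square order-`J` tail** (even sector), verbatim with `i, i' : ℕ`; `s₁, sm, sp` = sine lower-bound data.
[cite: Yoshida1992HermitianForms, §7 pp. 305–312] -/
noncomputable def U2EvenJMS (a θ η d₀ : ℝ) (B B₃ J : ℕ) (s₁ : ℕ → ℝ) (sm sp : ℕ → ℕ → ℝ) (i i' : ℕ) : ℝ :=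
  (1 + θ) * (1 + η) * (1 / (π ^ 2 * d₀))
            * (∑ j ∈ Finset.range J, ∑ j' ∈ Finset.range J, (((π / 4 + a * (1 + weilArchDensity (2 * a)) / (π * B₃)) ^ 2 + (∑ k ∈ weilPrimeIndex a, ((Λ k : ℝ) / Real.sqrt k) ^ 2) / 2 + 2 * (a * (1 + weilArchDensity (2 * a)) / (π * B₃)) * (∑ k ∈ weilPrimeIndex a, (Λ k : ℝ) / Real.sqrt k) + ((π / 2) * (∑ k ∈ weilPrimeIndex a, if s₁ k = 0 then (Λ k : ℝ) / Real.sqrt k else 0) + (∑ k ∈ weilPrimeIndex a, ∑ k' ∈ (weilPrimeIndex a).erase k, if sm k k' = 0 then (Λ k : ℝ) / Real.sqrt k * ((Λ k' : ℝ) / Real.sqrt k') else 0) / 2 + (∑ k ∈ weilPrimeIndex a, ∑ k' ∈ weilPrimeIndex a, if sp k k' = 0 then (Λ k : ℝ) / Real.sqrt k * ((Λ k' : ℝ) / Real.sqrt k') else 0) / 2)) * ((1 / (((2 * j + 1) + (2 * j' + 1) - 1 : ℕ) * (((B₃ - 1 : ℕ) : ℝ)) ^ ((2 * j + 1) + (2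 * j' + 1) - 1)) + 1 / (((2 * j + 1) + (2 * j' + 1) - 1 : ℕ) * (B₃ : ℝ) ^ ((2 * j + 1) + (2 * j' + 1) - 1))) / 2) + (if j = j' then ((π / 4 + a * (1 + weilArchDensity (2 * a)) / (π * B₃)) ^ 2 + (∑ k ∈ weilPrimeIndex a, ((Λ k : ℝ) / Real.sqrt k) ^ 2) / 2 + 2 * (a * (1 + weilArchDensity (2 * a)) / (π * B₃)) * (∑ k ∈ weilPrimeIndex a, (Λ k : ℝ) / Real.sqrt k) + ((π / 2) * (∑ k ∈ weilPrimeIndex a, if s₁ k = 0 then (Λ k : ℝ) / Real.sqrt k else 0) + (∑ k ∈ weilPrimeIndex a, ∑ k' ∈ (weilPrimeIndex a).erase k, if sm k k' = 0 then (Λ k : ℝ) / Real.sqrt k * ((Λ k' : ℝ) / Real.sqrt k') else 0) / 2 + (∑ k ∈ weilPrimeIndex a, ∑ k' ∈ weilPrimeIndex a, if sp k k' = 0 then (Λ k : ℝ) / Real.sqrt k * ((Λ k' : ℝ) / Real.sqrt k') else 0) / 2)) * (∑ j' ∈ Finset.range J, ((1 / (((2 * j + 1) + (2 * j' + 1) -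 1 : ℕ) * (((B₃ - 1 : ℕ) : ℝ)) ^ ((2 * j + 1) + (2 * j' + 1) - 1)) - 1 / (((2 * j + 1) + (2 * j' + 1) - 1 : ℕ) * (B₃ : ℝ) ^ ((2 * j + 1) + (2 * j' + 1) - 1))) / 2) * (B : ℝ) ^ (2 * j' + 1) / (B : ℝ) ^ (2 * j + 1)) + (∑ j' ∈ Finset.range J, ((π / 2) * (∑ k ∈ weilPrimeIndex a, (Λ k : ℝ) / Real.sqrt k / s₁ k) + (∑ k ∈ weilPrimeIndex a, ∑ k' ∈ (weilPrimeIndex a).erase k, (Λ k : ℝ) / Real.sqrt k * ((Λ k' : ℝ) / Real.sqrt k') / sm k k') / 2 + (∑ k ∈ weilPrimeIndex a, ∑ k' ∈ weilPrimeIndex a, (Λ k : ℝ) / Real.sqrt k * ((Λ k' : ℝ) / Real.sqrt k') / sp k k') / 2) / (B₃ : ℝ) ^ ((2 * j + 1) + (2 * j' + 1)) * (B : ℝ) ^ (2 * j' + 1) / (B : ℝ) ^ (2 * j + 1)) else 0)) * ((-1 : ℝ) ^ i * (i : ℝ) ^ (2 * j)) * ((-1 : ℝ) ^ i' * (i' :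 ℝ) ^ (2 * j')))
          + (1 + θ) * (1 + η⁻¹) * (1 / d₀)
            * (∑ r ∈ Finset.range J, ∑ r' ∈ Finset.range J, (((1 / (((2 * r + 2) + (2 * r' + 2) - 1 : ℕ) * (((B₃ - 1 : ℕ) : ℝ)) ^ ((2 * r + 2) + (2 * r' + 2) - 1)) + 1 / (((2 * r + 2) + (2 * r' + 2) - 1 : ℕ) * (B₃ : ℝ) ^ ((2 * r + 2) + (2 * r' + 2) - 1))) / 2) + (if r = r' then (∑ r' ∈ Finset.range J, ((1 / (((2 * r + 2) + (2 * r' + 2) - 1 : ℕ) * (((B₃ - 1 : ℕ) : ℝ)) ^ ((2 * r + 2) + (2 * r' + 2) - 1)) - 1 / (((2 * r + 2) + (2 * r' + 2) - 1 : ℕ) * (B₃ : ℝ) ^ ((2 * r + 2) + (2 * r' + 2) - 1))) / 2) * (B : ℝ) ^ (2 * r' + 2) / (B : ℝ) ^ (2 * r + 2)) else 0)) * ((-1 : ℝ) ^ i * (-((i : ℝ) ^ (2 * r + 1)) * ((Complex.digamma (1 / 4 + ((freq a i : ℝ) : ℂ) / 2 * I)).im / 2 + (∑ k ∈ weilPrimeIndex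 a, (Λ k : ℝ) / Real.sqrt k * Real.sin (freq a i * Real.log k)) - archExpSumSin a i) / π + 4 / a * (Real.exp (a / 2) - Real.exp (-(a / 2))) ^ 2 * (-1 : ℝ) ^ r * (a ^ 2 / (4 * π ^ 2)) ^ (r + 1) * (1 / (1 + 4 * freq a i ^ 2)))) * ((-1 : ℝ) ^ i' * (-((i' : ℝ) ^ (2 * r' + 1)) * ((Complex.digamma (1 / 4 + ((freq a i' : ℝ) : ℂ) / 2 * I)).im / 2 + (∑ k ∈ weilPrimeIndex a, (Λ k : ℝ) / Real.sqrt k * Real.sin (freq a i' * Real.log k)) - archExpSumSin a i') / π + 4 / a * (Real.exp (a / 2) - Real.exp (-(a / 2))) ^ 2 * (-1 : ℝ) ^ r' * (a ^ 2 / (4 * π ^ 2)) ^ (r' + 1) * (1 / (1 + 4 * freq a i' ^ 2)))))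
          + (if i = i' then (1 + θ⁻¹) * ((B : ℝ) / (d₀ * ((4 * J + 1 : ℕ) * (((B₃ - 1 : ℕ) : ℝ)) ^ (4 * J + 1)))) * (2 * (π / 4 + (∑ k ∈ weilPrimeIndex a, (Λ k : ℝ) / Real.sqrt k) + a * (1 + weilArchDensity (2 * a)) / π) * (i : ℝ) ^ (2 * J) / π + 4 / a * (Real.exp (a / 2) - Real.exp (-(a / 2))) ^ 2 * (a ^ 2 / (4 * π ^ 2)) ^ (J + 1) * (1 / (1 + 4 * freq a i ^ 2))) ^ 2 else 0)

/-- **Bridge**: the door's inline even mean-square tail matrix (indices in `Fin B`, sums over `Fin J`) is `U2EvenJMS`.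
[cite: Yoshida1992HermitianForms, §7 pp. 305–312] -/
theorem U2EvenJMS_fin (a θ η d₀ : ℝ) {B : ℕ} (B₃ J : ℕ) (s₁ : ℕ → ℝ) (sm sp : ℕ → ℕ → ℝ) (i i' : Fin B) :
    ((1 + θ) * (1 + η) * (1 / (π ^ 2 * d₀))
            * (∑ j : Fin J, ∑ j' : Fin J, (((π / 4 + a * (1 + weilArchDensity (2 * a)) / (π * B₃)) ^ 2 + (∑ k ∈ weilPrimeIndex a, ((Λ k : ℝ) / Real.sqrt k) ^ 2) / 2 + 2 * (a * (1 + weilArchDensity (2 * a)) / (π * B₃)) * (∑ k ∈ weilPrimeIndex a, (Λ k : ℝ) / Real.sqrt k) + ((π / 2) * (∑ k ∈ weilPrimeIndex a, if s₁ k = 0 then (Λ k : ℝ) / Real.sqrt k else 0) + (∑ k ∈ weilPrimeIndex a, ∑ k' ∈ (weilPrimeIndex a).erase k, if sm k k' = 0 then (Λ k : ℝ) / Real.sqrt k * ((Λ k' : ℝ) / Real.sqrt k') else 0) / 2 + (∑ k ∈ weilPrimeIndex a, ∑ k' ∈ weilPrimeIndex a, if sp k k' = 0 then (Λ k : ℝ)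 / Real.sqrt k * ((Λ k' : ℝ) / Real.sqrt k') else 0) / 2)) * ((1 / (((2 * (j : ℕ) + 1) + (2 * (j' : ℕ) + 1) - 1 : ℕ) * (((B₃ - 1 : ℕ) : ℝ)) ^ ((2 * (j : ℕ) + 1) + (2 * (j' : ℕ) + 1) - 1)) + 1 / (((2 * (j : ℕ) + 1) + (2 * (j' : ℕ) + 1) - 1 : ℕ) * (B₃ : ℝ) ^ ((2 * (j : ℕ) + 1) + (2 * (j' : ℕ) + 1) - 1))) / 2) + (if j = j' then ((π / 4 + a * (1 + weilArchDensity (2 * a)) / (π * B₃)) ^ 2 + (∑ k ∈ weilPrimeIndex a, ((Λ k : ℝ) / Real.sqrt k) ^ 2) / 2 + 2 * (a * (1 + weilArchDensity (2 * a)) / (π * B₃)) * (∑ k ∈ weilPrimeIndex a, (Λ k : ℝ) / Real.sqrt k) + ((π / 2) * (∑ k ∈ weilPrimeIndex a, if s₁ k = 0 then (Λ k : ℝ) / Real.sqrt k else 0) + (∑ k ∈ weilPrimeIndex a, ∑ k' ∈ (weilPrimeIndex a).erase k, if sm k k' = 0 then (Λ k : ℝ) / Real.sqrt k * ((Λ k'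 : ℝ) / Real.sqrt k') else 0) / 2 + (∑ k ∈ weilPrimeIndex a, ∑ k' ∈ weilPrimeIndex a, if sp k k' = 0 then (Λ k : ℝ) / Real.sqrt k * ((Λ k' : ℝ) / Real.sqrt k') else 0) / 2)) * (∑ j' : Fin J, ((1 / (((2 * (j : ℕ) + 1) + (2 * (j' : ℕ) + 1) - 1 : ℕ) * (((B₃ - 1 : ℕ) : ℝ)) ^ ((2 * (j : ℕ) + 1) + (2 * (j' : ℕ) + 1) - 1)) - 1 / (((2 * (j : ℕ) + 1) + (2 * (j' : ℕ) + 1) - 1 : ℕ) * (B₃ : ℝ) ^ ((2 * (j : ℕ) + 1) + (2 * (j' : ℕ) + 1) - 1))) / 2) * (B : ℝ) ^ (2 * (j' : ℕ) + 1) / (B : ℝ) ^ (2 * (j : ℕ) + 1)) + (∑ j' : Fin J, ((π / 2) * (∑ k ∈ weilPrimeIndex a, (Λ k : ℝ) / Real.sqrt k / s₁ k) + (∑ k ∈ weilPrimeIndex a, ∑ k' ∈ (weilPrimeIndex a).erase k, (Λ k : ℝ) / Real.sqrt k * ((Λ k' : ℝ) / Real.sqrt k') / sm k k') / 2 + (∑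 k ∈ weilPrimeIndex a, ∑ k' ∈ weilPrimeIndex a, (Λ k : ℝ) / Real.sqrt k * ((Λ k' : ℝ) / Real.sqrt k') / sp k k') / 2) / (B₃ : ℝ) ^ ((2 * (j : ℕ) + 1) + (2 * (j' : ℕ) + 1)) * (B : ℝ) ^ (2 * (j' : ℕ) + 1) / (B : ℝ) ^ (2 * (j : ℕ) + 1)) else 0)) * ((-1 : ℝ) ^ (i : ℕ) * (i : ℝ) ^ (2 * (j : ℕ))) * ((-1 : ℝ) ^ (i' : ℕ) * (i' : ℝ) ^ (2 * (j' : ℕ))))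
          + (1 + θ) * (1 + η⁻¹) * (1 / d₀)
            * (∑ r : Fin J, ∑ r' : Fin J, (((1 / (((2 * (r : ℕ) + 2) + (2 * (r' : ℕ) + 2) - 1 : ℕ) * (((B₃ - 1 : ℕ) : ℝ)) ^ ((2 * (r : ℕ) + 2) + (2 * (r' : ℕ) + 2) - 1)) + 1 / (((2 * (r : ℕ) + 2) + (2 * (r' : ℕ) + 2) - 1 : ℕ) * (B₃ : ℝ) ^ ((2 * (r : ℕ) + 2) + (2 * (r' : ℕ) + 2) - 1))) / 2) + (if r = r' then (∑ r' : Fin J, ((1 / (((2 * (r : ℕ) + 2) + (2 * (r' : ℕ) + 2) - 1 : ℕ) * (((B₃ - 1 : ℕ) : ℝ)) ^ ((2 * (r : ℕ) + 2) + (2 * (r' : ℕ) + 2) - 1)) - 1 / (((2 * (r : ℕ) + 2) + (2 * (r' : ℕ) + 2) - 1 : ℕ) * (B₃ : ℝ) ^ ((2 * (r : ℕ) + 2) + (2 * (r' : ℕ) + 2) - 1))) / 2) * (B : ℝ) ^ (2 * (r' : ℕ) + 2) / (B : ℝ) ^ (2 * (r : ℕ) + 2)) else 0)) * ((-1 : ℝ)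 ^ (i : ℕ) * (-((i : ℝ) ^ (2 * (r : ℕ) + 1)) * ((Complex.digamma (1 / 4 + ((freq a i : ℝ) : ℂ) / 2 * I)).im / 2 + (∑ k ∈ weilPrimeIndex a, (Λ k : ℝ) / Real.sqrt k * Real.sin (freq a i * Real.log k)) - archExpSumSin a i) / π + 4 / a * (Real.exp (a / 2) - Real.exp (-(a / 2))) ^ 2 * (-1 : ℝ) ^ (r : ℕ) * (a ^ 2 / (4 * π ^ 2)) ^ ((r : ℕ) + 1) * (1 / (1 + 4 * freq a i ^ 2)))) * ((-1 : ℝ) ^ (i' : ℕ) * (-((i' : ℝ) ^ (2 * (r' : ℕ) + 1)) * ((Complex.digamma (1 / 4 + ((freq a i' : ℝ) : ℂ) / 2 * I)).im / 2 + (∑ k ∈ weilPrimeIndex a, (Λ k : ℝ) / Real.sqrt k * Real.sin (freq a i' * Real.log k)) - archExpSumSin a i') / π + 4 / a * (Real.exp (a / 2) - Real.exp (-(a / 2))) ^ 2 * (-1 : ℝ) ^ (r' : ℕ) * (a ^ 2 / (4 * π ^ 2)) ^ ((r' : ℕ) + 1) * (1 / (1 + 4 * freq a i' ^ 2)))))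
          + (if i = i' then (1 + θ⁻¹) * ((B : ℝ) / (d₀ * ((4 * J + 1 : ℕ) * (((B₃ - 1 : ℕ) : ℝ)) ^ (4 * J + 1)))) * (2 * (π / 4 + (∑ k ∈ weilPrimeIndex a, (Λ k : ℝ) / Real.sqrt k) + a * (1 + weilArchDensity (2 * a)) / π) * (i : ℝ) ^ (2 * J) / π + 4 / a * (Real.exp (a / 2) - Real.exp (-(a / 2))) ^ 2 * (a ^ 2 / (4 * π ^ 2)) ^ (J + 1) * (1 / (1 + 4 * freq a i ^ 2))) ^ 2 else 0))
      = U2EvenJMS a θ η d₀ B B₃ J s₁ sm sp i i' := by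
  unfold U2EvenJMS
  simp only [Finset.sum_range, Fin.val_inj]

/-- **`U₂⁻` of the mean-square order-`J` tail** (odd sector), verbatim with `k, k' : ℕ` (kernel index `k` = mode `k + 1`).
[cite: Yoshida1992HermitianForms, §7 pp. 305–312] -/
noncomputable def U2OddJMS (a θ η d₀ : ℝ) (B B₃ J : ℕ) (s₁ : ℕ → ℝ) (sm sp : ℕ → ℕ → ℝ) (k k' : ℕ) : ℝ :=
  (1 + θ) * (1 + η) * (1 / (π ^ 2 * d₀))
            * (∑ j ∈ Finset.range J, ∑ j' ∈ Finset.range J, (((π / 4 + a * (1 + weilArchDensity (2 * a)) / (π * (((B₃ + 1 : ℕ) : ℝ)))) ^ 2 + (∑ k ∈ weilPrimeIndex a, ((Λ k : ℝ) / Real.sqrt k) ^ 2) / 2 + 2 * (a * (1 + weilArchDensity (2 * a)) / (π * (((B₃ + 1 : ℕ) : ℝ)))) * (∑ k ∈ weilPrimeIndex a, (Λ k : ℝ) / Real.sqrt k) + ((π / 2) * (∑ k ∈ weilPrimeIndex a, if s₁ k = 0 then (Λ k : ℝ) / Real.sqrt k else 0) + (∑ k ∈ weilPrimeIndex a, ∑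 k' ∈ (weilPrimeIndex a).erase k, if sm k k' = 0 then (Λ k : ℝ) / Real.sqrt k * ((Λ k' : ℝ) / Real.sqrt k') else 0) / 2 + (∑ k ∈ weilPrimeIndex a, ∑ k' ∈ weilPrimeIndex a, if sp k k' = 0 then (Λ k : ℝ) / Real.sqrt k * ((Λ k' : ℝ) / Real.sqrt k') else 0) / 2)) * ((1 / (((2 * j + 2) + (2 * j' + 2) - 1 : ℕ) * (B₃ : ℝ) ^ ((2 * j + 2) + (2 * j' + 2) - 1)) + 1 / (((2 * j + 2) + (2 * j' + 2) - 1 : ℕ) * ((B₃ + 1 : ℕ) : ℝ) ^ ((2 * j + 2) + (2 * j' + 2) - 1))) / 2) + (if j = j' then ((π / 4 + a * (1 + weilArchDensity (2 * a)) / (π * (((B₃ + 1 : ℕ) : ℝ)))) ^ 2 + (∑ k ∈ weilPrimeIndex a, ((Λ k : ℝ) / Real.sqrt k) ^ 2) / 2 + 2 * (a * (1 + weilArchDensity (2 * a)) / (π * (((B₃ + 1 : ℕ) : ℝ)))) * (∑ k ∈ weilPrimeIndex a, (Λ k : ℝ) / Real.sqrt k) + ((π / 2) * (∑ k ∈ weilPrimeIndex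 a, if s₁ k = 0 then (Λ k : ℝ) / Real.sqrt k else 0) + (∑ k ∈ weilPrimeIndex a, ∑ k' ∈ (weilPrimeIndex a).erase k, if sm k k' = 0 then (Λ k : ℝ) / Real.sqrt k * ((Λ k' : ℝ) / Real.sqrt k') else 0) / 2 + (∑ k ∈ weilPrimeIndex a, ∑ k' ∈ weilPrimeIndex a, if sp k k' = 0 then (Λ k : ℝ) / Real.sqrt k * ((Λ k' : ℝ) / Real.sqrt k') else 0) / 2)) * (∑ j' ∈ Finset.range J, ((1 / (((2 * j + 2) + (2 * j' + 2) - 1 : ℕ) * (B₃ : ℝ) ^ ((2 * j + 2) + (2 * j' + 2) - 1)) - 1 / (((2 * j + 2) + (2 * j' + 2) - 1 : ℕ) * ((B₃ + 1 : ℕ) : ℝ) ^ ((2 * j + 2) + (2 * j' + 2) - 1))) / 2) * (B : ℝ) ^ (2 * j' + 2) / (B : ℝ) ^ (2 * j + 2)) + (∑ j' ∈ Finset.range J, ((π / 2) * (∑ k ∈ weilPrimeIndex a, (Λ k : ℝ) / Real.sqrt k / s₁ k) + (∑ k ∈ weilPrimeIndex a, ∑ k' ∈ (weilPrimeIndex a).erase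 k, (Λ k : ℝ) / Real.sqrt k * ((Λ k' : ℝ) / Real.sqrt k') / sm k k') / 2 + (∑ k ∈ weilPrimeIndex a, ∑ k' ∈ weilPrimeIndex a, (Λ k : ℝ) / Real.sqrt k * ((Λ k' : ℝ) / Real.sqrt k') / sp k k') / 2) / (((B₃ + 1 : ℕ) : ℝ)) ^ ((2 * j + 2) + (2 * j' + 2)) * (B : ℝ) ^ (2 * j' + 2) / (B : ℝ) ^ (2 * j + 2)) else 0)) * ((-1 : ℝ) ^ (k + 1) * ((k : ℝ) + 1) ^ (2 * j + 1)) * ((-1 : ℝ) ^ (k' + 1) * ((k' : ℝ) + 1) ^ (2 * j' + 1)))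
          + (1 + θ) * (1 + η⁻¹) * (1 / d₀)
            * (∑ r ∈ Finset.range J, ∑ r' ∈ Finset.range J, (((1 / (((2 * r + 1) + (2 * r' + 1) - 1 : ℕ) * (B₃ : ℝ) ^ ((2 * r + 1) + (2 * r' + 1) - 1)) + 1 / (((2 * r + 1) + (2 * r' + 1) - 1 : ℕ) * ((B₃ + 1 : ℕ) : ℝ) ^ ((2 * r + 1) + (2 * r' + 1) - 1))) / 2) + (if r = r' then (∑ r' ∈ Finset.range J, ((1 / (((2 * r + 1) + (2 * r' + 1) - 1 : ℕ) * (B₃ : ℝ) ^ ((2 * r + 1) + (2 * r' + 1) - 1)) - 1 / (((2 * r + 1) + (2 * r' + 1) - 1 : ℕ) * ((B₃ + 1 : ℕ) : ℝ) ^ ((2 * r + 1) + (2 * r' + 1) - 1))) / 2) * (B : ℝ) ^ (2 * r' + 1) / (B : ℝ) ^ (2 * r + 1)) else 0)) * ((-1 : ℝ) ^ (k + 1) * (-(((k : ℝ) + 1) ^ (2 * r)) * ((Complex.digamma (1 / 4 + ((freq a ((k : ℤ) + 1) : ℝ) : ℂ) / 2 * I)).im / 2 + (∑ p ∈ weilPrimeIndex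 a, (Λ p : ℝ) / Real.sqrt p * Real.sin (freq a ((k : ℤ) + 1) * Real.log p)) - archExpSumSin a ((k : ℤ) + 1)) / π - 4 * (Real.exp (a / 2) - Real.exp (-(a / 2))) ^ 2 / π * (-1 : ℝ) ^ r * (a ^ 2 / (4 * π ^ 2)) ^ r * (freq a ((k : ℤ) + 1) / (1 + 4 * freq a ((k : ℤ) + 1) ^ 2)))) * ((-1 : ℝ) ^ (k' + 1) * (-(((k' : ℝ) + 1) ^ (2 * r')) * ((Complex.digamma (1 / 4 + ((freq a ((k' : ℤ) + 1) : ℝ) : ℂ) / 2 * I)).im / 2 + (∑ p ∈ weilPrimeIndex a, (Λ p : ℝ) / Real.sqrt p * Real.sin (freq a ((k' : ℤ) + 1) * Real.log p)) - archExpSumSin a ((k' : ℤ) + 1)) / π - 4 * (Real.exp (a / 2) - Real.exp (-(a / 2))) ^ 2 / π * (-1 : ℝ) ^ r' * (a ^ 2 / (4 * π ^ 2)) ^ r' * (freq a ((k' : ℤ) + 1) / (1 + 4 * freq a ((k' : ℤ) + 1) ^ 2)))))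
          + (if k = k' then (1 + θ⁻¹) * ((B : ℝ) / (d₀ * ((4 * J + 1 : ℕ) * (B₃ : ℝ) ^ (4 * J + 1)))) * (2 * (π / 4 + (∑ k ∈ weilPrimeIndex a, (Λ k : ℝ) / Real.sqrt k) + a * (1 + weilArchDensity (2 * a)) / π) * ((k : ℝ) + 1) ^ (2 * J) / π + 4 * (Real.exp (a / 2) - Real.exp (-(a / 2))) ^ 2 / π * (a ^ 2 / (4 * π ^ 2)) ^ J * (freq a ((k : ℤ) + 1) / (1 + 4 * freq a ((k : ℤ) + 1) ^ 2))) ^ 2 else 0)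

/-- **Bridge**: the door's inline odd mean-square tail matrix is `U2OddJMS`. [cite: Yoshida1992HermitianForms, §7 pp. 305–312] -/
theorem U2OddJMS_fin (a θ η d₀ : ℝ) {B : ℕ} (B₃ J : ℕ) (s₁ : ℕ → ℝ) (sm sp : ℕ → ℕ → ℝ) (k k' : Fin B) :
    ((1 + θ) * (1 + η) * (1 / (π ^ 2 * d₀))
            * (∑ j : Fin J, ∑ j' : Fin J, (((π / 4 + a * (1 + weilArchDensity (2 * a)) / (π * (((B₃ + 1 : ℕ) : ℝ)))) ^ 2 + (∑ k ∈ weilPrimeIndex a, ((Λ k : ℝ) / Real.sqrt k) ^ 2) / 2 + 2 * (a * (1 + weilArchDensity (2 * a)) / (π * (((B₃ + 1 : ℕ) : ℝ)))) * (∑ k ∈ weilPrimeIndex a, (Λ k : ℝ) / Real.sqrt k) + ((π / 2) * (∑ k ∈ weilPrimeIndex a, if s₁ k = 0 then (Λ k : ℝ) / Real.sqrt k else 0) + (∑ k ∈ weilPrimeIndex a, ∑ k' ∈ (weilPrimeIndex a).erase k, if sm k k' = 0 then (Λ k : ℝ) / Real.sqrt k * ((Λ k' : ℝ) / Real.sqrt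 k') else 0) / 2 + (∑ k ∈ weilPrimeIndex a, ∑ k' ∈ weilPrimeIndex a, if sp k k' = 0 then (Λ k : ℝ) / Real.sqrt k * ((Λ k' : ℝ) / Real.sqrt k') else 0) / 2)) * ((1 / (((2 * (j : ℕ) + 2) + (2 * (j' : ℕ) + 2) - 1 : ℕ) * (B₃ : ℝ) ^ ((2 * (j : ℕ) + 2) + (2 * (j' : ℕ) + 2) - 1)) + 1 / (((2 * (j : ℕ) + 2) + (2 * (j' : ℕ) + 2) - 1 : ℕ) * ((B₃ + 1 : ℕ) : ℝ) ^ ((2 * (j : ℕ) + 2) + (2 * (j' : ℕ) + 2) - 1))) / 2) + (if j = j' then ((π / 4 + a * (1 + weilArchDensity (2 * a)) / (π * (((B₃ + 1 : ℕ) : ℝ)))) ^ 2 + (∑ k ∈ weilPrimeIndex a, ((Λ k : ℝ) / Real.sqrt k) ^ 2) / 2 + 2 * (a * (1 + weilArchDensity (2 * a)) / (π * (((B₃ + 1 : ℕ) : ℝ)))) * (∑ k ∈ weilPrimeIndex a, (Λ k : ℝ) / Real.sqrt k) + ((π / 2) * (∑ k ∈ weilPrimeIndex a, if s₁ k = 0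 then (Λ k : ℝ) / Real.sqrt k else 0) + (∑ k ∈ weilPrimeIndex a, ∑ k' ∈ (weilPrimeIndex a).erase k, if sm k k' = 0 then (Λ k : ℝ) / Real.sqrt k * ((Λ k' : ℝ) / Real.sqrt k') else 0) / 2 + (∑ k ∈ weilPrimeIndex a, ∑ k' ∈ weilPrimeIndex a, if sp k k' = 0 then (Λ k : ℝ) / Real.sqrt k * ((Λ k' : ℝ) / Real.sqrt k') else 0) / 2)) * (∑ j' : Fin J, ((1 / (((2 * (j : ℕ) + 2) + (2 * (j' : ℕ) + 2) - 1 : ℕ) * (B₃ : ℝ) ^ ((2 * (j : ℕ) + 2) + (2 * (j' : ℕ) + 2) - 1)) - 1 / (((2 * (j : ℕ) + 2) + (2 * (j' : ℕ) + 2) - 1 : ℕ) * ((B₃ + 1 : ℕ) : ℝ) ^ ((2 * (j : ℕ) + 2) + (2 * (j' : ℕ) + 2) - 1))) / 2) * (B : ℝ) ^ (2 * (j' : ℕ) + 2) / (B : ℝ) ^ (2 * (j : ℕ) + 2)) + (∑ j' : Fin J, ((π / 2) * (∑ k ∈ weilPrimeIndex a, (Λ k : ℝ) / Real.sqrt k /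 s₁ k) + (∑ k ∈ weilPrimeIndex a, ∑ k' ∈ (weilPrimeIndex a).erase k, (Λ k : ℝ) / Real.sqrt k * ((Λ k' : ℝ) / Real.sqrt k') / sm k k') / 2 + (∑ k ∈ weilPrimeIndex a, ∑ k' ∈ weilPrimeIndex a, (Λ k : ℝ) / Real.sqrt k * ((Λ k' : ℝ) / Real.sqrt k') / sp k k') / 2) / (((B₃ + 1 : ℕ) : ℝ)) ^ ((2 * (j : ℕ) + 2) + (2 * (j' : ℕ) + 2)) * (B : ℝ) ^ (2 * (j' : ℕ) + 2) / (B : ℝ) ^ (2 * (j : ℕ) + 2)) else 0)) * ((-1 : ℝ) ^ ((k : ℕ) + 1) * (((k : ℕ) : ℝ) + 1) ^ (2 * (j : ℕ) + 1)) * ((-1 : ℝ) ^ ((k' : ℕ) + 1) * (((k' : ℕ) : ℝ) + 1) ^ (2 * (j' : ℕ) + 1)))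
          + (1 + θ) * (1 + η⁻¹) * (1 / d₀)
            * (∑ r : Fin J, ∑ r' : Fin J, (((1 / (((2 * (r : ℕ) + 1) + (2 * (r' : ℕ) + 1) - 1 : ℕ) * (B₃ : ℝ) ^ ((2 * (r : ℕ) + 1) + (2 * (r' : ℕ) + 1) - 1)) + 1 / (((2 * (r : ℕ) + 1) + (2 * (r' : ℕ) + 1) - 1 : ℕ) * ((B₃ + 1 : ℕ) : ℝ) ^ ((2 * (r : ℕ) + 1) + (2 * (r' : ℕ) + 1) - 1))) / 2) + (if r = r' then (∑ r' : Fin J, ((1 / (((2 * (r : ℕ) + 1) + (2 * (r' : ℕ) + 1) - 1 : ℕ) * (B₃ : ℝ) ^ ((2 * (r : ℕ) + 1) + (2 * (r' : ℕ) + 1) - 1)) - 1 / (((2 * (r : ℕ) + 1) + (2 * (r' : ℕ) + 1) - 1 : ℕ) * ((B₃ + 1 : ℕ) : ℝ) ^ ((2 * (r : ℕ) + 1) + (2 * (r' : ℕ) + 1) - 1))) / 2) * (B : ℝ) ^ (2 * (r' : ℕ) + 1) / (B : ℝ) ^ (2 * (r : ℕ) + 1)) else 0)) * ((-1 : ℝ)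 ^ ((k : ℕ) + 1) * (-((((k : ℕ) : ℝ) + 1) ^ (2 * (r : ℕ))) * ((Complex.digamma (1 / 4 + ((freq a (((k : ℕ) : ℤ) + 1) : ℝ) : ℂ) / 2 * I)).im / 2 + (∑ p ∈ weilPrimeIndex a, (Λ p : ℝ) / Real.sqrt p * Real.sin (freq a (((k : ℕ) : ℤ) + 1) * Real.log p)) - archExpSumSin a (((k : ℕ) : ℤ) + 1)) / π - 4 * (Real.exp (a / 2) - Real.exp (-(a / 2))) ^ 2 / π * (-1 : ℝ) ^ (r : ℕ) * (a ^ 2 / (4 * π ^ 2)) ^ (r : ℕ) * (freq a (((k : ℕ) : ℤ) + 1) / (1 + 4 * freq a (((k : ℕ) : ℤ) + 1) ^ 2)))) * ((-1 : ℝ) ^ ((k' : ℕ) + 1) * (-((((k' : ℕ) : ℝ) + 1) ^ (2 * (r' : ℕ))) * ((Complex.digamma (1 / 4 + ((freq a (((k' : ℕ) : ℤ) + 1) : ℝ) : ℂ) / 2 * I)).im / 2 + (∑ p ∈ weilPrimeIndex a, (Λ p : ℝ) / Real.sqrt p * Real.sin (freq a (((k' : ℕ) : ℤ) + 1) * Real.log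 p)) - archExpSumSin a (((k' : ℕ) : ℤ) + 1)) / π - 4 * (Real.exp (a / 2) - Real.exp (-(a / 2))) ^ 2 / π * (-1 : ℝ) ^ (r' : ℕ) * (a ^ 2 / (4 * π ^ 2)) ^ (r' : ℕ) * (freq a (((k' : ℕ) : ℤ) + 1) / (1 + 4 * freq a (((k' : ℕ) : ℤ) + 1) ^ 2)))))
          + (if k = k' then (1 + θ⁻¹) * ((B : ℝ) / (d₀ * ((4 * J + 1 : ℕ) * (B₃ : ℝ) ^ (4 * J + 1)))) * (2 * (π / 4 + (∑ k ∈ weilPrimeIndex a, (Λ k : ℝ) / Real.sqrt k) + a * (1 + weilArchDensity (2 * a)) / π) * (((k : ℕ) : ℝ) + 1) ^ (2 * J) / π + 4 * (Real.exp (a / 2) - Real.exp (-(a / 2))) ^ 2 / π * (a ^ 2 / (4 * π ^ 2)) ^ J * (freq a (((k : ℕ) : ℤ) + 1) / (1 + 4 * freq a (((k : ℕ) : ℤ) + 1) ^ 2))) ^ 2 else 0))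
      = U2OddJMS a θ η d₀ B B₃ J s₁ sm sp k k' := by
  unfold U2OddJMS
  simp only [Finset.sum_range, Fin.val_inj]

end Encl

end Literature.NumberTheory.LFunctions.Yoshida1992
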